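import Summits.BirchSwinnertonDyer.BirchSwinnertonDyer.Theorems.ByReductionTypeAtTwoOrdKatoHalfAtTwoIsoPosDiscNecessityTwist
import Summits.BirchSwinnertonDyer.BirchSwinnertonDyer.Theorems.ByReductionTypeAtTwoOrdKatoHalfAtTwoIsoGreenbergMuDefs
import Summits.BirchSwinnertonDyer.BirchSwinnertonDyer.Theorems.ByReductionTypeAtTwoOrdKatoHalfAtTwoIsoHintOfAbbesUllmo
import Summits.BirchSwinnertonDyer.Rank1Residual.X5.KatoOrdTwoMuPart
import Literature.NumberTheory.EllipticCurves.IsogenyIdProofs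
import HarnessLib

/-!
# Cert51b — crux-triage r1 seat 2 (GEN 51), crux `OrdKatoHalfAtTwoIso` (stmt-BirchSwinnertonDyer-19573), line `steinberg-fibre-at-two`:
# the `0 < Δ` conjunct ⟺ the LANDED G11⁺ decl, BY NAME on both sides (the by-name companion GEN 50 owed as «Cert50, unchecked»;
# the K4 `…PosDiscNecessityTwist` cone serves again on the farm since ≈ 17:10Z)

HONEST FRAMING (cell bsd-2adic): BSD is not proved by any of this; crux 202 is not proved; G11⁺ = `SteinbergFibreAtTwo.GreenbergMuZeroTwoOrdPosDisc`
(Greenberg LNM 1716 Conj. 1.11 at `p = 2` on the cell, p733065) and the conjunct `SteinbergFibreAtTwo.OrdKatoHalfAtTwoIsoPosDisc` are OPEN — each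
appears below only as a HYPOTHESIS or as one side of an `↔` under printed hypotheses. THEOREMS ONLY; no `def`, no `sorry`, no instance, no fact.

What the kernel certifies (acceptance rule §B of TRIAGE-r1-2, (a′) «neither stronger nor weaker than the item summand it replaces»):
* `posDisc_of_greenbergMu` — G11⁺ + Abbes–Ullmo + Kato 17.4 (1)(2)@2 ⟹ the conjunct (direct road; = `Cert51a.posDiscBody_of_greenbergMu` concluding
  the NAMED def; = w3 GEN 6's pending p734050 `ordKatoHalfAtTwoIsoPosDisc_of_greenbergMuZero`, same doors);
* `greenbergMu_of_posDisc` — the conjunct + PUB (`OrdPublishedInputsAtTwo`, K4 item 19149) + Cassels (`bsdRHS_eq_of_isIsogenous`) + Abbes–Ullmo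
  ⟹ G11⁺ (NECESSITY I `mu_eq_zero_of_posDisc`, lead g7 p702303, by name);
* `posDisc_iff_greenbergMu` — hence `OrdKatoHalfAtTwoIsoPosDisc ↔ GreenbergMuZeroTwoOrdPosDisc` granted PUB + Cassels + Abbes–Ullmo (all PRINT):
  registering G11⁺ as the v24 stub re-keys the `0 < Δ` half WITHOUT strengthening or weakening it modulo print;
* `fineSelmerConjATwoOrdPosDisc_of_greenbergMu` — G11⁺ + PUB ⟹ Q⁺ LITERALLY (∀ cyclotomic `κ`; the v24 draft's derived
  `stub_conjA_two_posDisc`, here with `stub_pub` a hypothesis): the Q⁺ summand of v23 is DISCHARGED by G11⁺, not silently dropped.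

References: R. Greenberg, LNM 1716 (1999) Conj. 1.11 p. 64 [GreenbergLNM1716]; K. Kato, Astérisque 295 (2004) Thm. 17.4 [Kato2004Asterisque];
A. Abbes–E. Ullmo, Compositio 103 (1996) Thm. A [AbbesUllmo1996]; J. Coates–R. Sujatha, Math. Ann. 331 (2005) Conj. A, Thm. 3.4 [CoatesSujatha2005];
J. S. Milne, ADT (2006) I.7.3 (Cassels) [MilneADT2006]; tree p702303, p703881, p733065, `Rank1Residual/X5/KatoOrdTwoMuPart`, `…HintOfAbbesUllmo`.
-/

set_option autoImplicit false
set_option linter.dupNamespace false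

noncomputable section

open scoped Classical MatrixGroups ModularForm NumberField
open CongruenceSubgroup WeierstrassCurve Field IsDedekindDomain NumberField
open Literature.NumberTheory.GaloisRepresentations
open Literature.NumberTheory.GaloisCohomology
open Literature.NumberTheory.EllipticCurves Literature.NumberTheory.EllipticCurves.ModularForms
open Literature.NumberTheory.EllipticCurves.Kato2004
open Literature.NumberTheory.EllipticCurves.Rank1Residual
open Literature.NumberTheory.EllipticCurves.Greenberg1999
open Literature.NumberTheory.EllipticCurves.SkinnerUrban2014
open Literature.NumberTheory.IwasawaTheory
open Summit.BirchSwinnertonDyer.Rank1Residual Summit.BirchSwinnertonDyer.Rank1Residual.X5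
open Summit.BirchSwinnertonDyer.BirchSwinnertonDyer.Theses.ByReductionTypeAtTwo
open Summit.BirchSwinnertonDyer.BirchSwinnertonDyer.Theorems.SteinbergFibreAtTwo

namespace Summit.BirchSwinnertonDyer.BirchSwinnertonDyer.Cruxes.OrdKatoHalfAtTwoIso.Cert51b

/-- Kato 17.4 (1)(2) at `2` extracted from the PUB item (third conjunct). [cite: Kato2004Asterisque, Thm. 17.4 (1)(2) (p. 273)] -/
theorem kato17_at_two_of_pub (hPub : OrdPublishedInputsAtTwo) :
    ∀ (V : WeierstrassCurve ℚ) [V.IsElliptic] [V.IsGloballyMinimal] [NeZero (V.conductorNorm ℤ)]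
      (f : CuspForm (Gamma0 (V.conductorNorm ℤ)) 2), kato_divisibility_allPrimes V 2 (f := f) := by
  obtain ⟨_, _, h17, _⟩ := hPub
  exact h17

/-- **SUFFICIENCY BY NAME: G11⁺ + Abbes–Ullmo + Kato 17.4 (1)(2)@2 ⟹ `OrdKatoHalfAtTwoIsoPosDisc`** (`W′ := W`; K4 doors
`O1.katoMuPartAtTwo_of_mu_eq_zero`, `O1.mainConjectureLowerDivisibilityAtTwoOrd_of_katoMuPartAtTwo`, the line's `hint_two_of_abbesUllmo_of_irr`).
CONDITIONAL on G11⁺ (OPEN); nothing closed. [cite: GreenbergLNM1716, Conj. 1.11 (p. 64)] [cite: Kato2004Asterisque, Thm. 17.4 (1)(2) (p. 273)]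
[cite: AbbesUllmo1996, Thm. A] -/
theorem posDisc_of_greenbergMu (hG : GreenbergMuZeroTwoOrdPosDisc) (hAU : abbesUllmo_not_dvd_maninConstant_of_not_dvd_level)
    (h17 : ∀ (V : WeierstrassCurve ℚ) [V.IsElliptic] [V.IsGloballyMinimal] [NeZero (V.conductorNorm ℤ)]
      (f : CuspForm (Gamma0 (V.conductorNorm ℤ)) 2), kato_divisibility_allPrimes V 2 (f := f)) :
    OrdKatoHalfAtTwoIsoPosDisc := by
  intro W _ _ hcm hr hgo h2 hΔ
  haveI : NeZero ((2 : ℕ) : ℚ) := ⟨by norm_num⟩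
  exact ⟨W, ‹_›, ‹_›, isIsogenous_self W,
    O1.mainConjectureLowerDivisibilityAtTwoOrd_of_katoMuPartAtTwo W (h17 W)
      (fun f hf ϖ hϖ => hint_two_of_abbesUllmo_of_irr hAU W hgo
        (hasIrreducibleModPGaloisRep_of_hasSurjectiveModNGaloisRep W 2 h2) f hf ϖ hϖ)
      (O1.katoMuPartAtTwo_of_mu_eq_zero W (hG W hcm hr hgo h2 hΔ))⟩

/-- **NECESSITY BY NAME: `OrdKatoHalfAtTwoIsoPosDisc` + PUB + Cassels + Abbes–Ullmo ⟹ G11⁺** (`mu_eq_zero_of_posDisc`, p702303).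
CONDITIONAL; nothing closed. [cite: Kato2004Asterisque, Thm. 17.4 (1)(2) (p. 273)] [cite: AbbesUllmo1996, Thm. A] [cite: MilneADT2006, Thm. I.7.3] -/
theorem greenbergMu_of_posDisc (hPos : OrdKatoHalfAtTwoIsoPosDisc) (hPub : OrdPublishedInputsAtTwo)
    (hCassels : bsdRHS_eq_of_isIsogenous) (hAU : abbesUllmo_not_dvd_maninConstant_of_not_dvd_level) :
    GreenbergMuZeroTwoOrdPosDisc :=
  fun W _ _ hcm hr hgo h2 hΔ _ _ hκ hγ hγ' D => mu_eq_zero_of_posDisc hPos hPub hCassels hAU W hcm hr hgo h2 hΔ hκ hγ hγ' D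

/-- **THE RE-KEYING IS EXACT MODULO PRINT: `OrdKatoHalfAtTwoIsoPosDisc ↔ GreenbergMuZeroTwoOrdPosDisc`** granted PUB (item 19149), Cassels
and Abbes–Ullmo. So the v24 stub G11⁺ is neither stronger nor weaker than the `0 < Δ` half it replaces (acceptance rule (a′)).
Both sides OPEN; nothing closed. [cite: GreenbergLNM1716, Conj. 1.11 (p. 64)] [cite: Kato2004Asterisque, Thm. 17.4 (1)(2) (p. 273)]
[cite: AbbesUllmo1996, Thm. A] [cite: MilneADT2006, Thm. I.7.3] -/
theorem posDisc_iff_greenbergMu (hPub : OrdPublishedInputsAtTwo) (hCassels : bsdRHS_eq_of_isIsogenous)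
    (hAU : abbesUllmo_not_dvd_maninConstant_of_not_dvd_level) :
    OrdKatoHalfAtTwoIsoPosDisc ↔ GreenbergMuZeroTwoOrdPosDisc :=
  ⟨fun hPos => greenbergMu_of_posDisc hPos hPub hCassels hAU,
    fun hG => posDisc_of_greenbergMu hG hAU (kato17_at_two_of_pub hPub)⟩

/-- **G11⁺ + PUB ⟹ Q⁺ = `FineSelmerConjATwoOrdPosDisc` LITERALLY** (∀ cyclotomic `κ`, `∃ γ D` spelling): at the canonical `κ_cyc`
(`χ₂(γ) = 5`, a cyclotomic variable with `ζ = 1`) `μ(X) = 0` ⇒ `Sel₀(W/ℚ_∞)[2]` finite (`finite_fineSelmerInfty_twoTorsion_of_forall_mu_eq_zero`),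
transported along `ker κ` (`finite_twoTorsion_fineSelmerInfty_of_isCyclotomic`, p703881) and converted back
(`IwasawaModuleFinitePadicInt.exists_fineSelmerDualData_moduleFinite_iff_finite_pTorsion`). = the v24 draft's derived `stub_conjA_two_posDisc`
with `stub_pub` / `stub_greenbergMu_two_posDisc` as hypotheses. CONDITIONAL; nothing closed.
[cite: CoatesSujatha2005, Conj. A and Thm. 3.4] [cite: GreenbergLNM1716, Conj. 1.11 (p. 64)] [cite: Kato2004Asterisque, Thm. 17.4 (1) (p. 273)] -/
theorem fineSelmerConjATwoOrdPosDisc_of_greenbergMu (hG : GreenbergMuZeroTwoOrdPosDisc) (hPub : OrdPublishedInputsAtTwo) :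
    FineSelmerConjATwoOrdPosDisc := by
  intro W _ _ hcm hr hgo h2 hΔ κ hκ
  obtain ⟨hmod, _, h17, _⟩ := hPub
  obtain ⟨γ, hγ, hχ⟩ := CyclotomicZp.exists_isTopGenerator_zpExtension 2
  have hγ' : IsCyclotomicVariable 2 γ := ⟨1, IsOfFinOrder.one, by rw [mul_one]; exact hχ⟩
  have hfin := finite_fineSelmerInfty_twoTorsion_of_forall_mu_eq_zero W (fun f ↦ h17 W f) hmod ⟨hgo.1, hgo.2⟩
    (CyclotomicZp.isCyclotomic_zpExtension 2) hγ hγ'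
    (fun D ↦ hG W hcm hr hgo h2 hΔ _ γ (CyclotomicZp.isCyclotomic_zpExtension 2) hγ hγ' D)
  have hfin' := finite_twoTorsion_fineSelmerInfty_of_isCyclotomic W (CyclotomicZp.isCyclotomic_zpExtension 2) hκ hfin
  obtain ⟨γ₀, hγ₀⟩ : ∃ γ₀ : absoluteGaloisGroup ℚ, κ.IsTopGenerator γ₀ := κ.surjective (Multiplicative.ofAdd 1)
  exact (IwasawaModuleFinitePadicInt.exists_fineSelmerDualData_moduleFinite_iff_finite_pTorsion W κ hγ₀).mpr hfin'

/-- **The v24 REGISTERED SET on the `0 < Δ` side is {G11⁺, bundle}: G11⁺ + PUB + Abbes–Ullmo ⟹ (the conjunct) ∧ Q⁺** — what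
`posDisc_of_stubs` and `stub_conjA_two_posDisc` of the draft deliver, by name, with the stubs as hypotheses. CONDITIONAL; nothing closed.
[cite: GreenbergLNM1716, Conj. 1.11 (p. 64)] [cite: Kato2004Asterisque, Thm. 17.4 (1)(2) (p. 273)] [cite: AbbesUllmo1996, Thm. A] -/
theorem posDisc_and_conjA_of_greenbergMu_of_pub (hG : GreenbergMuZeroTwoOrdPosDisc) (hPub : OrdPublishedInputsAtTwo)
    (hAU : abbesUllmo_not_dvd_maninConstant_of_not_dvd_level) :
    OrdKatoHalfAtTwoIsoPosDisc ∧ FineSelmerConjATwoOrdPosDisc :=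
  ⟨posDisc_of_greenbergMu hG hAU (kato17_at_two_of_pub hPub), fineSelmerConjATwoOrdPosDisc_of_greenbergMu hG hPub⟩

end Summit.BirchSwinnertonDyer.BirchSwinnertonDyer.Cruxes.OrdKatoHalfAtTwoIso.Cert51b

end
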